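import Mathlib
import Summits.KontsevichZagierPeriods.KontsevichZagierPeriods.Theorems.SoloInformedNashSymbol
import Summits.KontsevichZagierPeriods.KontsevichZagierPeriods.Theorems.SoloInformedCoonsPatch
import Summits.KontsevichZagierPeriods.KontsevichZagierPeriods.Theorems.SoloInformedKZStokesCube
import Literature.NumberTheory.Transcendental.SemialgebraicAlgebraicPoints
import HarnessLib

/-!
# SoloInformed — boxes, uniform Nash data and the Coons patch in a disc (toolkit for (HT))

File I2c-α of the (HT) step of the solo-informed programme (`SoloInformedNashHT`).  Elementary
facts used by the Coons-cell lemma `soloInformed_kappaPath_coons`: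

* values of a Nash map at algebraic times in `[0,1]` are algebraic points
  (`SoloInformedIsNashPath.isAlgebraic_apply`);
* Nash data on a *named* interval `(−ε, 1 + ε)` (`SoloInformedNashOn`), restriction to smaller `ε`
  and a common interval for four maps;
* the Coons patch of four curves with values in a disc of radius `ρ` about `w` stays within `3ρ`
  of `w` (`soloInformed_norm_coons_sub_le`);
* the open box `(−δ, 1 + δ)ᵐ` (`soloInformedUBox`): open, `ℚ`-semialgebraic for rational `δ`; the
  closed box `[−δ, 1 + δ]ᵐ` (`soloInformedCBox`): compact; and a
  rational box around `[0,1]ᵐ` inside the preimage of an open set (`soloInformed_exists_ubox`,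
  a thickening of the compact cube);
* `ReImSA` bookkeeping on `ℝᵐ`: real polynomial coefficients and one-variable maps read through
  a coordinate (`SoloInformedReImSA.comp_coord`).

References: Bochnak–Coste–Roy 1998, §2.2, §8.1; Huber–Wüstholz 2022, §3.3.1.
-/

noncomputable section

open scoped BigOperators Topology
open Set Metric MvPolynomial
open Literature.NumberTheory.Transcendental Literature.NumberTheory.Transcendental.KZ
open Literature.NumberTheory.Transcendental.CurvePeriods
open Literature.ModelTheory.ExponentialFields

namespace Summit.KontsevichZagierPeriods.KontsevichZagierPeriods.Theorems

variable {n : ℕ}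

/-! ## 1. Values of Nash maps at algebraic times -/

/-- A complex number with algebraic real and imaginary parts is algebraic. -/
theorem soloInformed_isAlgebraic_of_re_im {c : ℂ} (hre : IsAlgebraic ℚ c.re)
    (him : IsAlgebraic ℚ c.im) : IsAlgebraic ℚ c := by
  have h1 : IsAlgebraic ℚ (c.re : ℂ) :=
    (isAlgebraic_algebraMap_iff (A := ℂ) Complex.ofReal_injective).mpr hre
  have h2 : IsAlgebraic ℚ (c.im : ℂ) :=
    (isAlgebraic_algebraMap_iff (A := ℂ) Complex.ofReal_injective).mpr him
  have hI : IsAlgebraic ℚ Complex.I := by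
    refine ⟨Polynomial.X ^ 2 + 1, Polynomial.Monic.ne_zero (by monicity!), ?_⟩
    simp
  have h := h1.add (h2.mul hI)
  rwa [Complex.re_add_im] at h

/-- **The value of a Nash map at an algebraic time in `[0,1]` is an algebraic point.**
[BCR 1998, Prop. 2.2.6 (Tarski–Seidenberg)] -/
theorem SoloInformedIsNashPath.isAlgebraic_apply {γ : ℝ → Fin n → ℂ} (h : SoloInformedIsNashPath γ)
    {t : ℝ} (ht : t ∈ Icc (0 : ℝ) 1) (halg : IsAlgebraic ℚ t) (i : Fin n) :
    IsAlgebraic ℚ (γ t i) := by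
  obtain ⟨ε, hε, _, hsa⟩ := h
  have hε' : (0 : ℝ) < ε := by exact_mod_cast hε
  have htI : t ∈ Ioo (-(ε : ℝ)) (1 + ε) := ⟨by linarith [ht.1], by linarith [ht.2]⟩
  have hre := IsSemialgebraicFunOn.isAlgebraic_apply_one (S := Ioo (-(ε : ℝ)) (1 + ε))
    (u := fun u => (γ u i).re) (hsa i).1 htI halg
  have him := IsSemialgebraicFunOn.isAlgebraic_apply_one (S := Ioo (-(ε : ℝ)) (1 + ε))
    (u := fun u => (γ u i).im) (hsa i).2 htI halg
  exact soloInformed_isAlgebraic_of_re_im hre him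

/-- The value of a Nash map at a rational time in `[0,1]` is an algebraic point. -/
theorem SoloInformedIsNashPath.isAlgebraic_apply_rat {γ : ℝ → Fin n → ℂ}
    (h : SoloInformedIsNashPath γ) {q : ℚ} (hq : (q : ℝ) ∈ Icc (0 : ℝ) 1) (i : Fin n) :
    IsAlgebraic ℚ (γ q i) :=
  h.isAlgebraic_apply hq (isAlgebraic_algebraMap q) i

/-- The value of a Nash map at `k / N ∈ [0,1]` is an algebraic point. -/
theorem SoloInformedIsNashPath.isAlgebraic_apply_div {γ : ℝ → Fin n → ℂ}
    (h : SoloInformedIsNashPath γ) {k N : ℕ} (hN : 0 < N) (hk : k ≤ N) (i : Fin n) :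
    IsAlgebraic ℚ (γ ((k : ℝ) / N) i) := by
  have hq : (((k : ℚ) / N : ℚ) : ℝ) = (k : ℝ) / N := by push_cast; rfl
  have hN' : (0 : ℝ) < N := by exact_mod_cast hN
  have hmem : (k : ℝ) / N ∈ Icc (0 : ℝ) 1 :=
    ⟨div_nonneg (Nat.cast_nonneg k) hN'.le, (div_le_one hN').2 (by exact_mod_cast hk)⟩
  have := h.isAlgebraic_apply hmem (by rw [← hq]; exact isAlgebraic_algebraMap _) i
  exact this

/-! ## 2. Nash data on a named interval -/

/-- Nash data on the interval `(−ε, 1 + ε)`: `C¹` with `ℚ`-semialgebraic real and imaginary parts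
of all coordinates there. -/
def SoloInformedNashOn (ε : ℚ) (γ : ℝ → Fin n → ℂ) : Prop :=
  ContDiffOn ℝ 1 γ (Ioo (-(ε : ℝ)) (1 + ε)) ∧
    ∀ i, SoloInformedReImSA (soloInformedIoo1 (-(ε : ℝ)) (1 + ε)) (fun t => γ (t 0) i)

/-- A Nash map has Nash data on some rational interval. -/
theorem SoloInformedIsNashPath.exists_nashOn {γ : ℝ → Fin n → ℂ} (h : SoloInformedIsNashPath γ) :
    ∃ ε : ℚ, 0 < ε ∧ SoloInformedNashOn ε γ :=
  let ⟨ε, hε, hd, hsa⟩ := h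
  ⟨ε, hε, hd, hsa⟩

namespace SoloInformedNashOn

variable {ε : ℚ} {γ : ℝ → Fin n → ℂ}

/-- Nash data give a Nash map. -/
theorem isNashPath (hε : 0 < ε) (h : SoloInformedNashOn ε γ) : SoloInformedIsNashPath γ :=
  ⟨ε, hε, h.1, h.2⟩

/-- Restriction to a smaller interval. -/
theorem mono (h : SoloInformedNashOn ε γ) {ε' : ℚ} (hle : ε' ≤ ε) : SoloInformedNashOn ε' γ := by
  have hle' : (ε' : ℝ) ≤ ε := by exact_mod_cast hle
  have hsub : Ioo (-(ε' : ℝ)) (1 + ε') ⊆ Ioo (-(ε : ℝ)) (1 + ε) :=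
    Ioo_subset_Ioo (by linarith) (by linarith)
  have hsub1 : soloInformedIoo1 (-(ε' : ℝ)) (1 + ε') ⊆ soloInformedIoo1 (-(ε : ℝ)) (1 + ε) :=
    fun t ht => hsub ht
  have hs := isSemialgebraic_soloInformedIoo1 (-ε') (1 + ε')
  push_cast at hs
  exact ⟨h.1.mono hsub, fun i => (h.2 i).mono hsub1 hs⟩

/-- Coordinates are differentiable on the interval. -/
theorem hasDerivAt (h : SoloInformedNashOn ε γ) {u : ℝ} (hu : u ∈ Ioo (-(ε : ℝ)) (1 + ε))
    (i : Fin n) : HasDerivAt (fun u => γ u i) (deriv (fun u => γ u i) u) u :=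
  (soloInformed_differentiableAt_coord h.1 hu i).hasDerivAt

/-- Coordinates are continuous on the interval. -/
theorem continuousOn_apply (h : SoloInformedNashOn ε γ) (i : Fin n) :
    ContinuousOn (fun u => γ u i) (Ioo (-(ε : ℝ)) (1 + ε)) :=
  (continuous_apply i).comp_continuousOn h.1.continuousOn

/-- Coordinate derivatives are continuous on the interval. -/
theorem continuousOn_deriv (h : SoloInformedNashOn ε γ) (i : Fin n) :
    ContinuousOn (fun u => deriv (fun u => γ u i) u) (Ioo (-(ε : ℝ)) (1 + ε)) :=
  (contDiffOn_pi.mp h.1 i).continuousOn_deriv_of_isOpen isOpen_Ioo le_rfl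

/-- Coordinate derivatives have semialgebraic real and imaginary parts on the interval. -/
theorem reImSA_deriv (hε : 0 < ε) (h : SoloInformedNashOn ε γ) (i : Fin n) :
    SoloInformedReImSA (soloInformedIoo1 (-(ε : ℝ)) (1 + ε))
      (fun t => deriv (fun u => γ u i) (t 0)) :=
  soloInformed_reImSA_deriv hε h.1 h.2 i

end SoloInformedNashOn

/-- **Four Nash maps have Nash data on a common rational interval.** -/
theorem soloInformed_exists_nashOn₄ {γ₁ γ₂ γ₃ γ₄ : ℝ → Fin n → ℂ} (h₁ : SoloInformedIsNashPath γ₁)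
    (h₂ : SoloInformedIsNashPath γ₂) (h₃ : SoloInformedIsNashPath γ₃)
    (h₄ : SoloInformedIsNashPath γ₄) :
    ∃ ε : ℚ, 0 < ε ∧ SoloInformedNashOn ε γ₁ ∧ SoloInformedNashOn ε γ₂ ∧
      SoloInformedNashOn ε γ₃ ∧ SoloInformedNashOn ε γ₄ := by
  obtain ⟨ε₁, hε₁, n₁⟩ := h₁.exists_nashOn
  obtain ⟨ε₂, hε₂, n₂⟩ := h₂.exists_nashOn
  obtain ⟨ε₃, hε₃, n₃⟩ := h₃.exists_nashOn
  obtain ⟨ε₄, hε₄, n₄⟩ := h₄.exists_nashOn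
  refine ⟨min (min ε₁ ε₂) (min ε₃ ε₄), lt_min (lt_min hε₁ hε₂) (lt_min hε₃ hε₄),
    n₁.mono ?_, n₂.mono ?_, n₃.mono ?_, n₄.mono ?_⟩
  · exact (min_le_left _ _).trans (min_le_left _ _)
  · exact (min_le_left _ _).trans (min_le_right _ _)
  · exact (min_le_right _ _).trans (min_le_left _ _)
  · exact (min_le_right _ _).trans (min_le_right _ _)

/-! ## 3. The Coons patch of curves in a disc stays near the centre -/

/-- The Coons patch minus a constant, as a blend of the differences (the weights of the four edges
sum to `2`, those of the corner correction to `1`). -/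
theorem soloInformed_coons_sub_const (cB cT cL cR : ℝ → ℂ) (w : ℂ) (s t : ℝ) :
    soloInformedCoons cB cT cL cR s t - w =
      ((1 - t : ℝ) : ℂ) * (cB s - w) + (t : ℂ) * (cT s - w) + ((1 - s : ℝ) : ℂ) * (cL t - w) +
          (s : ℂ) * (cR t - w) -
        ((((1 - s) * (1 - t) : ℝ) : ℂ) * (cB 0 - w) + ((s * (1 - t) : ℝ) : ℂ) * (cB 1 - w) +
          (((1 - s) * t : ℝ) : ℂ) * (cT 0 - w) + ((s * t : ℝ) : ℂ) * (cT 1 - w)) := by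
  simp only [soloInformedCoons, soloInformedCoonsCorner]
  push_cast
  ring

/-- `‖r • x‖ ≤ r ρ` for a real weight `r ≥ 0` and `‖x‖ ≤ ρ`. -/
theorem soloInformed_norm_real_mul_le {r ρ : ℝ} {x : ℂ} (hr : 0 ≤ r) (hx : ‖x‖ ≤ ρ) :
    ‖((r : ℝ) : ℂ) * x‖ ≤ r * ρ := by
  rw [norm_mul, Complex.norm_real, Real.norm_of_nonneg hr]
  exact mul_le_mul_of_nonneg_left hx hr

/-- **The Coons patch of four curves with values within `ρ` of `w` (on the parameter square) is
within `3ρ` of `w`.** -/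
theorem soloInformed_norm_coons_sub_le {cB cT cL cR : ℝ → ℂ} {w : ℂ} {ρ s t : ℝ}
    (hs : s ∈ Icc (0 : ℝ) 1) (ht : t ∈ Icc (0 : ℝ) 1)
    (hB : ‖cB s - w‖ ≤ ρ) (hT : ‖cT s - w‖ ≤ ρ) (hL : ‖cL t - w‖ ≤ ρ) (hR : ‖cR t - w‖ ≤ ρ)
    (hB0 : ‖cB 0 - w‖ ≤ ρ) (hB1 : ‖cB 1 - w‖ ≤ ρ) (hT0 : ‖cT 0 - w‖ ≤ ρ)
    (hT1 : ‖cT 1 - w‖ ≤ ρ) :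
    ‖soloInformedCoons cB cT cL cR s t - w‖ ≤ 3 * ρ := by
  rw [soloInformed_coons_sub_const]
  obtain ⟨hs0, hs1⟩ := hs
  obtain ⟨ht0, ht1⟩ := ht
  have e1 := soloInformed_norm_real_mul_le (sub_nonneg.2 ht1) hB
  have e2 := soloInformed_norm_real_mul_le ht0 hT
  have e3 := soloInformed_norm_real_mul_le (sub_nonneg.2 hs1) hL
  have e4 := soloInformed_norm_real_mul_le hs0 hR
  have c1 := soloInformed_norm_real_mul_le (mul_nonneg (sub_nonneg.2 hs1) (sub_nonneg.2 ht1)) hB0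
  have c2 := soloInformed_norm_real_mul_le (mul_nonneg hs0 (sub_nonneg.2 ht1)) hB1
  have c3 := soloInformed_norm_real_mul_le (mul_nonneg (sub_nonneg.2 hs1) ht0) hT0
  have c4 := soloInformed_norm_real_mul_le (mul_nonneg hs0 ht0) hT1
  have hA := ((norm_add_le_of_le (norm_add_le_of_le (norm_add_le_of_le e1 e2) e3) e4))
  have hC := ((norm_add_le_of_le (norm_add_le_of_le (norm_add_le_of_le c1 c2) c3) c4))
  refine (norm_sub_le _ _).trans ((add_le_add hA hC).trans ?_)
  nlinarith

/-! ## 4. Boxes around the unit cube -/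

/-- The open box `(−δ, 1 + δ)ᵐ`. -/
def soloInformedUBox (m : ℕ) (δ : ℝ) : Set (Fin m → ℝ) := {z | ∀ i, z i ∈ Ioo (-δ) (1 + δ)}

/-- Membership in the open box. -/
@[simp] theorem soloInformed_mem_ubox {m : ℕ} {δ : ℝ} {z : Fin m → ℝ} :
    z ∈ soloInformedUBox m δ ↔ ∀ i, z i ∈ Ioo (-δ) (1 + δ) := Iff.rfl

/-- The open box is open. -/
theorem soloInformed_isOpen_ubox (m : ℕ) (δ : ℝ) : IsOpen (soloInformedUBox m δ) := by
  have h : soloInformedUBox m δ = ⋂ i, (fun z : Fin m → ℝ => z i) ⁻¹' Ioo (-δ) (1 + δ) := by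
    ext z; simp [soloInformedUBox]
  rw [h]
  exact isOpen_iInter_of_finite fun i => isOpen_Ioo.preimage (continuous_apply i)

/-- The open box with rational half-width is `ℚ`-semialgebraic. -/
theorem soloInformed_isSemialgebraic_ubox (m : ℕ) (δ : ℚ) :
    IsSemialgebraic ℚ (soloInformedUBox m (δ : ℝ)) := by
  have h : soloInformedUBox m (δ : ℝ) = ⋂ i ∈ (Finset.univ : Finset (Fin m)),
      ({x | aeval x (C (-δ) : MvPolynomial (Fin m) ℚ) < aeval x (X i : MvPolynomial (Fin m) ℚ)} ∩
        {x | aeval x (X i : MvPolynomial (Fin m) ℚ) <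
          aeval x (C (1 + δ) : MvPolynomial (Fin m) ℚ)}) := by
    ext x
    simp [soloInformedUBox]
  rw [h]
  exact IsSemialgebraic.biInter _ _ fun i _ =>
    (isSemialgebraic_setOf_eval_lt _ _).inter (isSemialgebraic_setOf_eval_lt _ _)

/-- A smaller box lies in a bigger one. -/
theorem soloInformed_ubox_mono (m : ℕ) {δ δ' : ℝ} (h : δ' ≤ δ) :
    soloInformedUBox m δ' ⊆ soloInformedUBox m δ := fun z hz i =>
  ⟨by linarith [(hz i).1], by linarith [(hz i).2]⟩

/-- The unit cube lies in every open box of positive half-width. -/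
theorem soloInformed_cube_subset_ubox (m : ℕ) {δ : ℝ} (hδ : 0 < δ) :
    soloInformedCube m ⊆ soloInformedUBox m δ := fun z hz i =>
  ⟨by linarith [(hz i).1], by linarith [(hz i).2]⟩

/-- Points of the closed box `[−δ, 1 + δ]ᵐ` lie in the open box of any bigger half-width. -/
theorem soloInformed_mem_ubox_of_Icc {m : ℕ} {δ δ' : ℝ} (h : δ < δ') {z : Fin m → ℝ}
    (hz : ∀ i, z i ∈ Icc (-δ) (1 + δ)) : z ∈ soloInformedUBox m δ' := fun i =>
  ⟨by linarith [(hz i).1], by linarith [(hz i).2]⟩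

/-- Coordinates of points of the box `(−δ, 1 + δ)ᵐ` lie in `(−ε, 1 + ε)` for `δ ≤ ε`. -/
theorem soloInformed_apply_mem_Ioo_of_mem_ubox {m : ℕ} {δ ε : ℝ} (h : δ ≤ ε) {z : Fin m → ℝ}
    (hz : z ∈ soloInformedUBox m δ) (i : Fin m) : z i ∈ Ioo (-ε) (1 + ε) :=
  ⟨by linarith [(hz i).1], by linarith [(hz i).2]⟩

/-- The closed box `[−δ, 1 + δ]ᵐ`. -/
def soloInformedCBox (m : ℕ) (δ : ℝ) : Set (Fin m → ℝ) := {z | ∀ i, z i ∈ Icc (-δ) (1 + δ)}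

/-- Membership in the closed box. -/
@[simp] theorem soloInformed_mem_cbox {m : ℕ} {δ : ℝ} {z : Fin m → ℝ} :
    z ∈ soloInformedCBox m δ ↔ ∀ i, z i ∈ Icc (-δ) (1 + δ) := Iff.rfl

/-- The closed box is an order interval of `ℝᵐ`. -/
theorem soloInformed_cbox_eq_Icc (m : ℕ) (δ : ℝ) :
    soloInformedCBox m δ = Icc (fun _ => -δ) (fun _ => 1 + δ) := by
  ext z
  simp only [soloInformed_mem_cbox, mem_Icc, Pi.le_def]
  exact ⟨fun h => ⟨fun i => (h i).1, fun i => (h i).2⟩, fun h i => ⟨h.1 i, h.2 i⟩⟩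

/-- The closed box is compact. -/
theorem soloInformed_isCompact_cbox (m : ℕ) (δ : ℝ) : IsCompact (soloInformedCBox m δ) := by
  rw [soloInformed_cbox_eq_Icc]
  exact isCompact_Icc

/-- The open box lies in the closed box of the same half-width. -/
theorem soloInformed_ubox_subset_cbox (m : ℕ) (δ : ℝ) :
    soloInformedUBox m δ ⊆ soloInformedCBox m δ := fun _ hz i => ⟨(hz i).1.le, (hz i).2.le⟩

/-- The closed box lies in every open box of bigger half-width. -/
theorem soloInformed_cbox_subset_ubox (m : ℕ) {δ δ' : ℝ} (h : δ < δ') :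
    soloInformedCBox m δ ⊆ soloInformedUBox m δ' := fun _ hz => soloInformed_mem_ubox_of_Icc h hz

/-- The unit cube lies in every closed box of nonnegative half-width. -/
theorem soloInformed_cube_subset_cbox (m : ℕ) {δ : ℝ} (hδ : 0 ≤ δ) :
    soloInformedCube m ⊆ soloInformedCBox m δ := fun z hz i =>
  ⟨by linarith [(hz i).1], by linarith [(hz i).2]⟩

/-- **A rational closed box around `[0,1]ᵐ` inside the preimage of an open set.**  If `h` is
continuous on the box `(−ε, 1 + ε)ᵐ` and maps `[0,1]ᵐ` into the open set `U`, then it maps a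
closed box `[−δ, 1 + δ]ᵐ`, `δ ∈ ℚ`, `0 < δ < ε`, into `U`. -/
theorem soloInformed_exists_ubox {m : ℕ} {X : Type*} [TopologicalSpace X] {h : (Fin m → ℝ) → X}
    {ε : ℝ} (hε : 0 < ε) (hc : ContinuousOn h (soloInformedUBox m ε)) {U : Set X}
    (hU : IsOpen U) (hKU : ∀ z ∈ soloInformedCube m, h z ∈ U) :
    ∃ δ : ℚ, 0 < δ ∧ (δ : ℝ) < ε ∧ ∀ z : Fin m → ℝ, (∀ i, z i ∈ Icc (-(δ : ℝ)) (1 + δ)) → h z ∈ U := by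
  have hO : IsOpen (soloInformedUBox m ε ∩ h ⁻¹' U) :=
    hc.isOpen_inter_preimage (soloInformed_isOpen_ubox m ε) hU
  have hKO : soloInformedCube m ⊆ soloInformedUBox m ε ∩ h ⁻¹' U := fun z hz =>
    ⟨soloInformed_cube_subset_ubox m hε hz, hKU z hz⟩
  obtain ⟨r, hr, hrO⟩ := (isCompact_soloInformedCube m).exists_thickening_subset_open hO hKO
  obtain ⟨δ, hδ0, hδr⟩ := exists_rat_btwn (lt_min hr hε)
  refine ⟨δ, by exact_mod_cast hδ0, lt_of_lt_of_le hδr (min_le_right _ _), fun z hz => ?_⟩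
  have hδr' : (δ : ℝ) < r := lt_of_lt_of_le hδr (min_le_left _ _)
  suffices hzO : z ∈ soloInformedUBox m ε ∩ h ⁻¹' U from hzO.2
  refine hrO ?_
  rw [Metric.mem_thickening_iff]
  refine ⟨fun i => max 0 (min (z i) 1), soloInformed_mem_cube_iff.2 fun i =>
    ⟨le_max_left _ _, max_le zero_le_one (min_le_right _ _)⟩, ?_⟩
  rw [dist_pi_lt_iff hr]
  intro i
  obtain ⟨h1, h2⟩ := hz i
  rw [Real.dist_eq]
  rcases le_total (z i) 0 with hz0 | hz0
  · have e : max 0 (min (z i) 1) = 0 :=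
      max_eq_left ((min_le_left _ _).trans hz0)
    rw [e, abs_lt]; constructor <;> linarith
  · rcases le_total (z i) 1 with hz1 | hz1
    · have e : max 0 (min (z i) 1) = z i := by rw [min_eq_left hz1, max_eq_right hz0]
      rw [e, sub_self, abs_zero]; exact hr
    · have e : max 0 (min (z i) 1) = 1 := by rw [min_eq_right hz1, max_eq_right zero_le_one]
      rw [e, abs_lt]; constructor <;> linarith

/-! ## 5. `ReImSA` bookkeeping on `ℝᵐ` -/

/-- Coordinate functions are `ℚ`-semialgebraic. -/
theorem soloInformed_sa_coord {m : ℕ} {s : Set (Fin m → ℝ)} (hs : IsSemialgebraic ℚ s) (i : Fin m) :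
    IsSemialgebraicFunOn ℚ s (fun z => z i) :=
  (isSemialgebraicFunOn_aeval hs (X i)).congr fun z _ => by simp

namespace SoloInformedReImSA

variable {m : ℕ} {s : Set (Fin m → ℝ)}

/-- Real `ℚ`-semialgebraic functions, read as complex-valued ones. -/
theorem ofReal (hs : IsSemialgebraic ℚ s) {f : (Fin m → ℝ) → ℝ} (hf : IsSemialgebraicFunOn ℚ s f) :
    SoloInformedReImSA s (fun z => ((f z : ℝ) : ℂ)) :=
  re_im_ofReal hs hf

/-- A coordinate, read as a complex-valued function. -/
theorem coord (hs : IsSemialgebraic ℚ s) (i : Fin m) :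
    SoloInformedReImSA s (fun z => ((z i : ℝ) : ℂ)) :=
  ofReal hs (soloInformed_sa_coord hs i)

/-- `1 − zᵢ`, read as a complex-valued function. -/
theorem one_sub_coord (hs : IsSemialgebraic ℚ s) (i : Fin m) :
    SoloInformedReImSA s (fun z => ((1 - z i : ℝ) : ℂ)) :=
  ofReal hs (((isSemialgebraicFunOn_aeval hs (1 - X i))).congr fun z _ => by simp)

/-- Subtraction. -/
theorem sub {F G : (Fin m → ℝ) → ℂ} (hs : IsSemialgebraic ℚ s) (hF : SoloInformedReImSA s F)
    (hG : SoloInformedReImSA s G) : SoloInformedReImSA s (fun z => F z - G z) := by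
  have h := hF.add ((const hs (isAlgebraic_one.neg : IsAlgebraic ℚ (-1 : ℂ))).mul hG)
  exact h.congr fun z _ => by ring

/-- Negation. -/
theorem neg {F : (Fin m → ℝ) → ℂ} (hs : IsSemialgebraic ℚ s) (hF : SoloInformedReImSA s F) :
    SoloInformedReImSA s (fun z => -F z) := by
  have h := (const hs (isAlgebraic_one.neg : IsAlgebraic ℚ (-1 : ℂ))).mul hF
  exact h.congr fun z _ => by ring

/-- **A one-variable `ReImSA` map read through the coordinate `zᵢ`.** [BCR 1998, Prop. 2.2.6] -/
theorem comp_coord (hs : IsSemialgebraic ℚ s) {S : Set (Fin 1 → ℝ)} {c : (Fin 1 → ℝ) → ℂ}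
    (hc : SoloInformedReImSA S c) (i : Fin m) (hmaps : ∀ z ∈ s, (fun _ : Fin 1 => z i) ∈ S) :
    SoloInformedReImSA s (fun z => c (fun _ => z i)) := by
  have hπ : IsSemialgebraicMapOn ℚ s (fun (z : Fin m → ℝ) (_ : Fin 1) => z i) := by
    convert isSemialgebraicMapOn_aeval hs (fun _ : Fin 1 => (X i : MvPolynomial (Fin m) ℚ))
      using 2 with z
    ext j
    simp
  exact ⟨IsSemialgebraicFunOn.comp_isSemialgebraicMapOn_holds hc.1 hπ hmaps,
    IsSemialgebraicFunOn.comp_isSemialgebraicMapOn_holds hc.2 hπ hmaps⟩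

end SoloInformedReImSA

end Summit.KontsevichZagierPeriods.KontsevichZagierPeriods.Theorems
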